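import Summits.NavierStokesRegularity.NavierStokesRegularity.Theorems.TypeICertificateLadderTargetStretchingChannelsTwist
import HarnessLib

/-!
# Crux `Target` = `TypeICertificateLadder.NoTypeIBlowup` (stmt-NavierStokesRegularity-1217), line
# `depletion-ladder`: THE VORTICITY-SIDE CHANNELS OF ENSTROPHY PRODUCTION, IV — RUNG ONE IS BINORMAL: of the
# velocity only the ONE scalar component along `ω × curl ω` produces enstrophy, and it must reach the
# self-similar rate `√(ν/(T−t))` (constant ONE) at a singular time

`--supports stmt-NavierStokesRegularity-1217` (helper; file 4 of the channel series, consumer of `…ChannelsTwist` and of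
the log-mean amplitude glue `hasSmoothExtensionPast_of_logIntegral_amplitude_of_depletion`, p586364). Author: STA
lineage `ns-sta-19551-p1` (g12).

In the Lamb form `J = ∫⟪u, ω × curl ω⟫` the velocity is paired with ONE vector field, so only the scalar
`u_b := ⟪u, b̂⟫`, `b̂ = (ω × curl ω)/|ω × curl ω|` (a unit vector in the normal plane of the vortex line: in the Frenet
frame `ω × curl ω = |ω|(∇_⊥|ω| − |ω|κ n)`), produces enstrophy. This sharpens g11's normal-velocity rung
(`…TargetNormalVelocityRung`: the two components of `u ⟂ ω`, hypothesis `|u × ω| ≤ M_⊥|ω|`) to a single component,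
with the same sharp constant `1`, and combines with file II (twist is blind):

* `abs_integral_stretching_le_binormalAmplitude` — on the class of `StretchingDepletion`: if
  `|⟪u, ω × curl ω⟫| ≤ M_b |ω × curl ω|` pointwise then `|∫J| ≤ M_b · ‖ω‖₂ · ‖ξ × curl ω‖₂ ≤ M_b ‖ω‖₂ ‖curl ω‖₂`
  (`…_le_binormalAmplitude'`).
* `binormalAmplitude_along_flow` — along a classical Leray–Hopf rapidly-decaying-datum flow: `|J(t)| ≤ M_b(t)‖ω‖₂‖∇ω‖₂`.
* `hasSmoothExtensionPast_of_logIntegral_binormalAmplitude` — **THE BINORMAL RUNG (log-mean form)**: an onset `t₁` and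
  a majorant `m_b(t)` of `|u_b|` on the support of `ω × curl ω` with `∫_{t₁}^t m_b² ≤ ν(A log((T−t₁)/(T−t)) + B)`,
  `A < 1` ⇒ smooth extension past `T` — no hypothesis on the other two velocity components (Type I or not).
* `hasSmoothExtensionPast_of_binormalVelocityRate` — sup form: eventually `√(T−t)|⟪u, ω×curl ω⟫| ≤ C_b√ν|ω×curl ω|`,
  `0 ≤ C_b < 1` ⇒ extension; `frequently_binormalVelocity_gt_of_not_hasSmoothExtensionPast` — PORTRAIT: at a singular
  time the binormal speed exceeds `C_b√(ν/(T−t))` somewhere on `{ω × curl ω ≠ 0}`, at times accumulating at `T`, for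
  every `C_b < 1`.

Census of the trilinear density `det[u, ω, curl ω]` after files I–IV (+ g6, g11): exactly one velocity component
(`u_b`), exactly one `curl ω` component structure (`ξ × curl ω`, twist blind), and in transport form exactly one
derivative of `ω` (`∂_ξω`). WHAT THIS IS NOT: conditional criteria; nothing here excludes a blow-up. [folklore]

References: Berselli–Córdoba, C. R. Acad. Sci. 347 (2009); Farhat–Grujić, arXiv:1804.08238 (near-Beltrami depletion);
P. Constantin, Comm. Math. Phys. 129 (1990), (2.9)–(2.11).
-/

noncomputable section

open Set Filter Topology MeasureTheory
open scoped RealInnerProductSpace ENNReal NNReal ContDiff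
open Literature.Analysis.FluidPDE

namespace Summit.NavierStokesRegularity.NavierStokesRegularity.Theorems.DepletionLadder

-- the problem directory repeats the summit name (`NavierStokesRegularity/NavierStokesRegularity`)
set_option linter.dupNamespace false

open Summit.NavierStokesRegularity.NavierStokesRegularity.Theorems.RungReynoldsOne

namespace Channels

variable {v : EuclideanSpace ℝ (Fin 3) → EuclideanSpace ℝ (Fin 3)}

/-! ## Kinematics: only `⟪u, b̂⟫` pairs with `ω × curl ω` -/

/-- **The binormal bound** on the class of `StretchingDepletion` (`v ∈ C²` divergence free, `|v| ≤ M`, `ω = curl v ∈ L²`,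
`|∇ω|_F ∈ L²`, integrable stretching density): if `|⟪v, ω × curl ω⟫| ≤ M_b |ω × curl ω|` pointwise, then
`|∫⟪ω, Dv ω⟫| ≤ M_b · ‖ω‖₂ · (∫‖ω × curl ω‖²/‖ω‖²)^{1/2}` (Lamb form + Cauchy–Schwarz; the last factor is
`‖ξ × curl ω‖₂ ≤ ‖curl ω‖₂`). [folklore] -/
theorem abs_integral_stretching_le_binormalAmplitude (hv : ContDiff ℝ 2 v) (hdiv : VectorCalculus.IsDivFree v)
    {M Mb : ℝ} (hM : ∀ x, ‖v x‖ ≤ M)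
    (hMb : ∀ x, |⟪v x, cross (curl v x) (curl (curl v) x)⟫| ≤ Mb * ‖cross (curl v x) (curl (curl v) x)‖)
    (iZ : Integrable (fun x => ‖curl v x‖ ^ 2))
    (iA : Integrable (fun x => frobeniusNormSq (fderiv ℝ (curl v) x)))
    (iJ : Integrable (fun x => ⟪curl v x, fderiv ℝ v x (curl v x)⟫)) :
    |∫ x, ⟪curl v x, fderiv ℝ v x (curl v x)⟫| ≤
      Mb * Real.sqrt (∫ x, ‖curl v x‖ ^ 2) *
        Real.sqrt (∫ x, ‖cross (curl v x) (curl (curl v) x)‖ ^ 2 / ‖curl v x‖ ^ 2) := by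
  rw [integral_stretching_eq_integral_inner_cross hv hdiv hM iZ iA iJ]
  obtain ⟨itr, -, -⟩ := integral_transversalCurlSq_le hv iA
  have hw1 : ContDiff ℝ 1 (curl v) := contDiff_one_curl_of_contDiff_two hv
  have cw : Continuous (curl v) := hw1.continuous
  have cc : Continuous (curl (curl v)) := continuous_curl hw1
  have ccross : Continuous fun x => cross (curl v x) (curl (curl v) x) :=
    (crossCLM.continuous.comp cw).clm_apply cc
  by_cases hex : ∃ x, cross (curl v x) (curl (curl v) x) ≠ 0
  · obtain ⟨x₀, hx₀⟩ := hex
    have hMb0 : 0 ≤ Mb := by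
      have hpos : 0 < ‖cross (curl v x₀) (curl (curl v) x₀)‖ := norm_pos_iff.2 hx₀
      nlinarith [hMb x₀, abs_nonneg ⟪v x₀, cross (curl v x₀) (curl (curl v) x₀)⟫]
    set g : EuclideanSpace ℝ (Fin 3) → ℝ :=
      fun x => ‖cross (curl v x) (curl (curl v) x)‖ / ‖curl v x‖ with hgdef
    have hg0 : ∀ x, 0 ≤ g x := fun x => by positivity
    have hgm : AEStronglyMeasurable g volume :=
      (ccross.norm.measurable.div cw.norm.measurable).aestronglyMeasurable
    have hg2 : Integrable (fun x => g x ^ 2) := by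
      refine itr.congr (Eventually.of_forall fun x => ?_)
      simp only [hgdef, div_pow]
    have hpt : ∀ x, |⟪v x, cross (curl v x) (curl (curl v) x)⟫| ≤ Mb * (‖curl v x‖ * g x) := fun x => by
      calc |⟪v x, cross (curl v x) (curl (curl v) x)⟫| ≤ Mb * ‖cross (curl v x) (curl (curl v) x)‖ := hMb x
        _ = Mb * (‖curl v x‖ * g x) := by
            rw [hgdef]; simp only
            by_cases h0 : curl v x = 0
            · have : cross (curl v x) (curl (curl v) x) = 0 := by
                rw [h0]; simp [cross]
              rw [this, h0]; simp
            · rw [mul_div_cancel₀ _ (norm_ne_zero_iff.2 h0)]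
    have mw : MemLp (fun x => ‖curl v x‖) 2 volume := memLp_two_norm_curl hv iZ
    have mg : MemLp g 2 volume := (memLp_two_iff_integrable_sq hgm).2 hg2
    have iprod : Integrable (fun x => ‖curl v x‖ * g x) := mw.integrable_mul mg
    have h1 : |∫ x, ⟪v x, cross (curl v x) (curl (curl v) x)⟫| ≤ Mb * ∫ x, ‖curl v x‖ * g x := by
      rw [← integral_const_mul]
      exact (abs_integral_le_integral_abs).trans (integral_mono_of_nonneg (Eventually.of_forall fun x =>
        abs_nonneg _) (iprod.const_mul Mb) (Eventually.of_forall hpt))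
    have hcs : ∫ x, ‖curl v x‖ * g x ≤
        Real.sqrt (∫ x, ‖curl v x‖ ^ 2) * Real.sqrt (∫ x, g x ^ 2) :=
      integral_mul_le_sqrt_mul_sqrt (μ := volume) (fun x => norm_nonneg _) hg0
        cw.norm.aestronglyMeasurable hgm iZ hg2
    have hg2eq : ∫ x, g x ^ 2 = ∫ x, ‖cross (curl v x) (curl (curl v) x)‖ ^ 2 / ‖curl v x‖ ^ 2 :=
      integral_congr_ae (Eventually.of_forall fun x => by simp only [hgdef, div_pow])
    calc |∫ x, ⟪v x, cross (curl v x) (curl (curl v) x)⟫| ≤ Mb * ∫ x, ‖curl v x‖ * g x := h1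
      _ ≤ Mb * (Real.sqrt (∫ x, ‖curl v x‖ ^ 2) * Real.sqrt (∫ x, g x ^ 2)) :=
          mul_le_mul_of_nonneg_left hcs hMb0
      _ = _ := by rw [hg2eq]; ring
  · -- `ω × curl ω ≡ 0`: both sides vanish
    push Not at hex
    have h0 : (fun x => ⟪v x, cross (curl v x) (curl (curl v) x)⟫) = fun _ => 0 := by
      funext x; rw [hex x, inner_zero_right]
    have hX0 : ∫ x, ‖cross (curl v x) (curl (curl v) x)‖ ^ 2 / ‖curl v x‖ ^ 2 = 0 := by
      simp [hex]
    rw [h0, integral_zero, abs_zero, hX0, Real.sqrt_zero, mul_zero]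

/-- **The binormal bound, palinstrophy form**: same hypotheses with `0 ≤ M_b`:
`|∫⟪ω, Dv ω⟫| ≤ M_b · ‖ω‖₂ · ‖curl ω‖₂` (`‖ξ × curl ω‖₂ ≤ ‖curl ω‖₂`, file II). [folklore] -/
theorem abs_integral_stretching_le_binormalAmplitude' (hv : ContDiff ℝ 2 v) (hdiv : VectorCalculus.IsDivFree v)
    {M Mb : ℝ} (hM : ∀ x, ‖v x‖ ≤ M) (hMb0 : 0 ≤ Mb)
    (hMb : ∀ x, |⟪v x, cross (curl v x) (curl (curl v) x)⟫| ≤ Mb * ‖cross (curl v x) (curl (curl v) x)‖)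
    (iZ : Integrable (fun x => ‖curl v x‖ ^ 2))
    (iA : Integrable (fun x => frobeniusNormSq (fderiv ℝ (curl v) x)))
    (iJ : Integrable (fun x => ⟪curl v x, fderiv ℝ v x (curl v x)⟫)) :
    |∫ x, ⟪curl v x, fderiv ℝ v x (curl v x)⟫| ≤
      Mb * Real.sqrt (∫ x, ‖curl v x‖ ^ 2) * Real.sqrt (∫ x, ‖curl (curl v) x‖ ^ 2) := by
  have h := abs_integral_stretching_le_binormalAmplitude hv hdiv hM hMb iZ iA iJ
  obtain ⟨-, -, hle⟩ := integral_transversalCurlSq_le hv iA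
  have htw0 : 0 ≤ ∫ x, ⟪curl v x, curl (curl v) x⟫ ^ 2 / ‖curl v x‖ ^ 2 :=
    integral_nonneg fun x => by positivity
  have hle' : ∫ x, ‖cross (curl v x) (curl (curl v) x)‖ ^ 2 / ‖curl v x‖ ^ 2 ≤
      ∫ x, ‖curl (curl v) x‖ ^ 2 := by linarith
  exact h.trans (mul_le_mul_of_nonneg_left (Real.sqrt_le_sqrt hle') (by positivity))

/-! ## Along a flow, the rung and its portrait -/

/-- **The binormal bound along a flow.** For a classical Leray–Hopf rapidly-decaying-datum solution on `[0,T)`, every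
`t ∈ [0,T)` and every `M_b ≥ 0` with `|⟪u(t,x), ω × curl ω⟫| ≤ M_b |ω × curl ω|` for all `x`:
`|∫⟪ω, Du ω⟫| ≤ M_b · ‖ω(t)‖₂ · ‖∇ω(t)‖₂` (Tao cover ⇒ slice class; `‖curl ω‖₂ = ‖∇ω‖₂`). [folklore] -/
theorem binormalAmplitude_along_flow {ν T : ℝ} (hν : 0 < ν) (hT : 0 < T)
    {u : ℝ → EuclideanSpace ℝ (Fin 3) → EuclideanSpace ℝ (Fin 3)}
    {p : ℝ → EuclideanSpace ℝ (Fin 3) → ℝ}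
    (hsol : IsClassicalNSSolutionOn (Ico 0 T) ν 0 u p) (hLH : IsLerayHopfOn T ν 0 (u 0) u)
    (hdec : HasRapidSpatialDecay (u 0)) :
    ∀ t ∈ Ico 0 T, ∀ Mb : ℝ, 0 ≤ Mb →
      (∀ x, |⟪u t x, cross (curl (u t) x) (curl (curl (u t)) x)⟫| ≤
        Mb * ‖cross (curl (u t) x) (curl (curl (u t)) x)‖) →
      |∫ x, ⟪curl (u t) x, fderiv ℝ (u t) x (curl (u t) x)⟫| ≤
        Mb * Real.sqrt (∫ x, ‖curl (u t) x‖ ^ 2) *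
          Real.sqrt (∫ x, frobeniusNormSq (fderiv ℝ (curl (u t)) x)) := by
  intro t ht Mb hMb0 hMb
  have ht' : (t + T) / 2 ∈ Ioo 0 T := ⟨by linarith [ht.1], by linarith [ht.2]⟩
  obtain ⟨q, hsolt, hut, -, -⟩ := stub_taoCover hν hT hsol hLH hdec ht'
  have htI : t ∈ Icc 0 ((t + T) / 2) := ⟨ht.1, by linarith [ht.2]⟩
  obtain ⟨B₀, -, hB₀⟩ := exists_forall_norm_le_of_hasBoundedSobolevNormsOn hsolt hut
  obtain ⟨iZ, iA, iJ⟩ := slice_integrability hsolt hut htI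
  have hv : ContDiff ℝ ∞ (u t) := hsol.contDiff_velocity ht
  have h := abs_integral_stretching_le_binormalAmplitude' (hv.of_le (by norm_cast)) (hsol.divFree t ht)
    (hB₀ t htI) hMb0 hMb iZ iA iJ
  rwa [integral_norm_curl_curl_sq_eq (hv.of_le (by norm_cast)) iZ iA] at h

/-- **THE BINORMAL RUNG (log-mean form).** A classical Leray–Hopf rapidly-decaying-datum solution on `[0,T)` which,
from some onset `t₁`, admits a non-negative majorant `m_b` of its binormal speed —
`|⟪u(t,x), ω × curl ω⟫| ≤ m_b(t)|ω × curl ω|` for `t ∈ [t₁,T)` — with `m_b²` locally interval integrable and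
`∫_{t₁}^t m_b² ≤ ν(A log((T−t₁)/(T−t)) + B)`, `A < 1`, extends smoothly past `T`. No hypothesis on the two other
velocity components. [folklore] -/
theorem hasSmoothExtensionPast_of_logIntegral_binormalAmplitude {ν T t₁ A B : ℝ} (hν : 0 < ν) (hT : 0 < T)
    (hA : A < 1) (ht₁ : t₁ ∈ Ico 0 T)
    {u : ℝ → EuclideanSpace ℝ (Fin 3) → EuclideanSpace ℝ (Fin 3)}
    {p : ℝ → EuclideanSpace ℝ (Fin 3) → ℝ}
    (hsol : IsClassicalNSSolutionOn (Ico 0 T) ν 0 u p) (hLH : IsLerayHopfOn T ν 0 (u 0) u)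
    (hdec : HasRapidSpatialDecay (u 0))
    {m : ℝ → ℝ} (hm0 : ∀ t ∈ Ico t₁ T, 0 ≤ m t)
    (hamp : ∀ t ∈ Ico t₁ T, ∀ x, |⟪u t x, cross (curl (u t) x) (curl (curl (u t)) x)⟫| ≤
      m t * ‖cross (curl (u t) x) (curl (curl (u t)) x)‖)
    (hii : ∀ t ∈ Ico t₁ T, IntervalIntegrable (fun τ => m τ ^ 2) volume t₁ t)
    (hint : ∀ t ∈ Ico t₁ T, ∫ τ in t₁..t, m τ ^ 2 ≤ ν * (A * Real.log ((T - t₁) / (T - t)) + B)) :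
    HasSmoothExtensionPast ν 0 u T := by
  have hA' : (1 : ℝ) ^ 2 * A < 1 := by simpa using hA
  refine hasSmoothExtensionPast_of_logIntegral_amplitude_of_depletion hν hT hA' ht₁ hsol hLH hdec hii
    (fun t ht => ?_) hint
  rw [one_mul]
  exact binormalAmplitude_along_flow hν hT hsol hLH hdec t ⟨ht₁.1.trans ht.1, ht.2⟩ (m t) (hm0 t ht) (hamp t ht)

/-- **The binormal rung, sup form.** If eventually (as `t ↑ T`)
`√(T−t)·|⟪u(t,x), ω × curl ω⟫| ≤ C_b √ν |ω × curl ω|` for all `x`, with `0 ≤ C_b < 1`, the classical Leray–Hopf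
rapidly-decaying-datum solution extends smoothly past `T` — whatever the other velocity components do. [folklore] -/
theorem hasSmoothExtensionPast_of_binormalVelocityRate {ν T Cb : ℝ} (hν : 0 < ν) (hT : 0 < T) (hCb0 : 0 ≤ Cb)
    (hCb : Cb < 1)
    {u : ℝ → EuclideanSpace ℝ (Fin 3) → EuclideanSpace ℝ (Fin 3)}
    {p : ℝ → EuclideanSpace ℝ (Fin 3) → ℝ}
    (hsol : IsClassicalNSSolutionOn (Ico 0 T) ν 0 u p) (hLH : IsLerayHopfOn T ν 0 (u 0) u)
    (hdec : HasRapidSpatialDecay (u 0))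
    (hrate : ∀ᶠ t in 𝓝[<] T, ∀ x,
      Real.sqrt (T - t) * |⟪u t x, cross (curl (u t) x) (curl (curl (u t)) x)⟫| ≤
        Cb * Real.sqrt ν * ‖cross (curl (u t) x) (curl (curl (u t)) x)‖) :
    HasSmoothExtensionPast ν 0 u T := by
  obtain ⟨a, haT, hsub⟩ := mem_nhdsLT_iff_exists_Ioo_subset.1 hrate
  set t₁ : ℝ := max a 0 / 2 + T / 2 with ht₁def
  have hmax : max a 0 < T := max_lt haT hT
  have ht₁ : t₁ ∈ Ico 0 T := by
    refine ⟨?_, ?_⟩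
    · have := le_max_right a 0; rw [ht₁def]; linarith
    · rw [ht₁def]; linarith
  have hat₁ : a < t₁ := by have := le_max_left a 0; rw [ht₁def]; linarith
  -- the amplitude `m(τ) = C_b √ν / √(T−τ)`
  set m : ℝ → ℝ := fun τ => Cb * Real.sqrt ν / Real.sqrt (T - τ) with hmdef
  have hm2 : ∀ τ, τ < T → m τ ^ 2 = Cb ^ 2 * ν / (T - τ) := by
    intro τ hτ
    have hTτ : 0 < T - τ := sub_pos.2 hτ
    rw [hmdef]; simp only
    rw [div_pow, mul_pow, Real.sq_sqrt hν.le, Real.sq_sqrt hTτ.le]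
  have hm0 : ∀ t ∈ Ico t₁ T, 0 ≤ m t := fun t ht => by rw [hmdef]; positivity
  have hamp : ∀ t ∈ Ico t₁ T, ∀ x, |⟪u t x, cross (curl (u t) x) (curl (curl (u t)) x)⟫| ≤
      m t * ‖cross (curl (u t) x) (curl (curl (u t)) x)‖ := by
    intro t ht x
    have hTt : 0 < Real.sqrt (T - t) := Real.sqrt_pos.2 (sub_pos.2 ht.2)
    have h := hsub ⟨hat₁.trans_le ht.1, ht.2⟩ x
    rw [hmdef]; simp only
    rw [div_mul_eq_mul_div, le_div_iff₀ hTt]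
    linarith
  have hcont : ∀ t ∈ Ico t₁ T, ContinuousOn (fun τ => m τ ^ 2) (uIcc t₁ t) := by
    intro t ht
    have : ∀ τ ∈ uIcc t₁ t, τ < T := fun τ hτ => by
      rw [uIcc_of_le ht.1] at hτ; exact hτ.2.trans_lt ht.2
    refine ContinuousOn.pow (ContinuousOn.div continuousOn_const
      (Real.continuous_sqrt.comp_continuousOn (continuousOn_const.sub continuousOn_id)) fun τ hτ => ?_) 2
    exact (Real.sqrt_pos.2 (sub_pos.2 (this τ hτ))).ne'
  have hii : ∀ t ∈ Ico t₁ T, IntervalIntegrable (fun τ => m τ ^ 2) volume t₁ t := fun t ht =>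
    (hcont t ht).intervalIntegrable
  have hint : ∀ t ∈ Ico t₁ T, ∫ τ in t₁..t, m τ ^ 2 ≤ ν * (Cb ^ 2 * Real.log ((T - t₁) / (T - t)) + 0) := by
    intro t ht
    have heq : ∫ τ in t₁..t, m τ ^ 2 = ∫ τ in t₁..t, (Cb ^ 2 * ν) / (T - τ) := by
      refine intervalIntegral.integral_congr fun τ hτ => ?_
      rw [uIcc_of_le ht.1] at hτ
      exact hm2 τ (hτ.2.trans_lt ht.2)
    rw [heq, integral_const_div_sub ht.1 ht.2]
    linarith
  have hA : Cb ^ 2 < 1 := by nlinarith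
  exact hasSmoothExtensionPast_of_logIntegral_binormalAmplitude hν hT hA ht₁ hsol hLH hdec hm0 hamp hii hint

/-- **Portrait of a singular time: the binormal speed reaches the self-similar rate.** If the classical Leray–Hopf
rapidly-decaying-datum solution does NOT extend past `T`, then for every `0 ≤ C_b < 1` it is NOT eventually true
that `√(T−t)·|⟪u, ω × curl ω⟫| ≤ C_b√ν|ω × curl ω|` everywhere: the ONE velocity component along `ω × curl ω`
exceeds `C_b √(ν/(T−t))` somewhere on `{ω × curl ω ≠ 0}`, at times accumulating at `T`. [folklore] -/
theorem frequently_binormalVelocity_gt_of_not_hasSmoothExtensionPast {ν T Cb : ℝ} (hν : 0 < ν) (hT : 0 < T)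
    (hCb0 : 0 ≤ Cb) (hCb : Cb < 1)
    {u : ℝ → EuclideanSpace ℝ (Fin 3) → EuclideanSpace ℝ (Fin 3)}
    {p : ℝ → EuclideanSpace ℝ (Fin 3) → ℝ}
    (hsol : IsClassicalNSSolutionOn (Ico 0 T) ν 0 u p) (hLH : IsLerayHopfOn T ν 0 (u 0) u)
    (hdec : HasRapidSpatialDecay (u 0)) (hsing : ¬ HasSmoothExtensionPast ν 0 u T) :
    ∃ᶠ t in 𝓝[<] T, ∃ x,
      Cb * Real.sqrt ν * ‖cross (curl (u t) x) (curl (curl (u t)) x)‖ <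
        Real.sqrt (T - t) * |⟪u t x, cross (curl (u t) x) (curl (curl (u t)) x)⟫| := by
  by_contra h
  have h' : ∀ᶠ t in 𝓝[<] T, ∀ x,
      Real.sqrt (T - t) * |⟪u t x, cross (curl (u t) x) (curl (curl (u t)) x)⟫| ≤
        Cb * Real.sqrt ν * ‖cross (curl (u t) x) (curl (curl (u t)) x)‖ := by
    simp only [Filter.not_frequently, not_exists, not_lt] at h
    exact h
  exact hsing (hasSmoothExtensionPast_of_binormalVelocityRate hν hT hCb0 hCb hsol hLH hdec h')

end Channels

end Summit.NavierStokesRegularity.NavierStokesRegularity.Theorems.DepletionLadder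

end
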